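import Summits.QuantumFields.YangMills.Theorems.BalabanUVNodesN19MultiplicityByName

/-!
# BalabanUVNodes ∕ N19 — the bracket (T) «Lipschitz in the background with polynomially growing constant» DERIVED BY NAME from
# [III] (2.27)(ii)'s ANALYTIC-MARGIN shape + (2.28) + the printed upper running of the couplings ((2.6) ∕ (0.31)), via the tree's
# `T4TowerRateDischarge.lipBackground_of_analyticMargin` ∕ `polyLipGrowth_of_couplingMargin(_flowIneq26)`; knit v7 = v6 + (T)
# (seat dag-n19-a gen 3, on dag-lead's word [DAGLEAD-G2-WORDS-71]; Track A node N19, cluster K5; count-neutral)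

HONEST FRAMING.  NE7 is NOT PRINTED and NOT proved.  After knits v5 ((S) by name, p417754) and v6 ((M) by name, p420073) the N19 edge's
remaining non-object binder was the bracket (T): `LipBackground EA W κ CU` with `PolyLipGrowth CU g Pg q` — «the scale-`j` E-term of run A is
Lipschitz in the background through the carrier's gauge, with a constant growing at most polynomially in the remaining scales `K − j`»,
printed-GRADE: [Balaban1988Convergent] (2.27)(ii) p. 259 prints that the E-terms are ANALYTIC on the complex neighbourhood `U^c_j(X, α₀, α₁)`
of the background, (2.28) p. 259 the radius `α_{·,j} = g_j·C·(log g_j^{−2})^q` (so `≥ c₀·g_j`), and the flow control (2.6) p. 255 ∕ [I] (0.31)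
the running `1∕g_j² ≤ 1∕g_K² + β′(K − j)`; a Cauchy estimate on the shrunk domain then gives the Lipschitz constant `4E₀∕ϱ ≤ (4E₀∕c₀)(1∕gIR +
√β′)·(K − j + 1)` — the tree's `T4TowerRateDischarge.lipBackground_of_analyticMargin` (Cauchy step, `Dimock2015.norm_sub_le_of_margin`) and
`polyLipGrowth_of_couplingMargin` ∕ `…_flowIneq26` ∕ `…_discrete031` (cell pub-balaban t4 lineage).  THIS FILE consumes them BY NAME:

* §1 `core_summable_of_ledgerAtSync_marginByName` — knit v6 (`N19MultiplicityByName.core_summable_of_ledgerAtSync_multByName`) with the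
  binders `hU hG hPg` REPLACED by the DISPLAYED analytic-margin reading of run A's functional `EA` on the window `W` — an embedding `ιE` of
  run-A backgrounds into a complex normed space dominated by the carrier's gauge, domains `Dm s X`, radii `ϱ s j > 0`, holomorphic extensions
  `Ec s X` bounded by `E₀m·e^{−κd(X)}` and agreeing with the real values, closed balls of radius `ϱ s (scale X)` inside the domains (the SHAPE
  of (2.27)(ii), quantitative margin NOT printed) —, the margin in coupling units `c₀·s j ≤ ϱ s j` ((2.28)), and the upper running
  `1∕(g K j)² ≤ 1∕gIR² + β′·(K − j)` for `j ≤ K` (from (2.6) `B14.FlowIneq26` by `invSq_le_of_flowIneq26`, or from (0.31) by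
  `invSq_le_of_discrete031`; at the datum with a run offset `K₀` the extra `β′K₀` is absorbed into `gIR`).  CONCLUSION unchanged:
  `∃ δ, NE7.Core l₀ vol T Bad A B δ ∧ Summable δ`.
* §2 `core_summable_of_ledgerAtSync_flow26ByName` — the same with the running clause supplied by the PRINTED (2.6) `B14.Thm`-style shape
  `∀ K, B14.FlowIneq26 (g K) β′ β₀ K` at every cutoff table pinned at its infrared end `g K K = gIR` (tables indexed with the cutoff at index `K`,
  as in `T4TowerRateDischarge`).

After v7 every analytic input of the N19 edge on the term-wise road is BY NAME: N14 · N16 · N17 · N18 · N22 (DAG in-edges), [III] (2.43), the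
(0.26)∕(1.26) census, (2.27)(ii)–(2.28) + (2.6) for (T); what remains is OBJECT-bound ((2.25) term format, reference-ledger inclusion, booking,
other kinds' factorisation, identifications, `one`; cell NODE O ∕ the record predicates) plus the liaison conventions (`GaugeDominated`, the
readings family, the margin data themselves).  One finite four-torus at fixed ε, rung (B)+1; NOT infinite volume, NOT OS on ℝ⁴, NOT a mass gap,
NOT Clay.  Nothing of Bałaban's asserted or instantiated; N19 NOT discharged; count-neutral.  THEOREMS ONLY; 0 sorry; standard axioms.

CITATION HEADER (LOCATIONS only).  [Balaban1988Convergent] (2.27)(ii), (2.28) p. 259; (2.6) p. 255 (`B14.FlowIneq26`); [Balaban1987RG1] (0.31)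
p. 259; [DimockYuan2024GNFlow] proof of Thm 4 (the Cauchy device, as cited in `T4TowerRateDischarge`).
-/

set_option autoImplicit false

noncomputable section

open Finset MeasureTheory
open scoped BigOperators

namespace Summit.QuantumFields.YangMills.BalabanUVNodes.N19MarginByName

open Literature.MathematicalPhysics.QuantumFieldTheory.Balaban1983to89
open T4OutputRate T4RecentScale T4GoodClassBudget T4CauchySum T4TowerRateComposition T4TowerRateDischarge
open T4EtaRateMin (Readings NE3Shape)
open T4RateLiaison (GaugeDominated)
open TreeLengthTorus (TFaceConnected torusTreeLen)
open B12TreeDecay (kappa₀)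
open Summit.QuantumFields.BalabanUV.T4Continuum.Spine
open Summit.QuantumFields.BalabanUV.T4Continuum.NE1p.DressedRoot (DressedTower DressedStabilityStrict)
open Summit.QuantumFields.YangMills.BalabanUVNodes.N19LedgerLinkSync (LedgerDataSync LedgerAtSync)
open Summit.QuantumFields.YangMills.BalabanUVNodes.N19MultiplicityByName (core_summable_of_ledgerAtSync_multByName)

section Edge

variable {C : Carriers} [DecidableEq C.Dom] {F : Type*} {ι X : Type} [MeasurableSpace ι] {σ : Type*} [DecidableEq σ]
  {L : LedgerDataSync C F ι σ} {l₀ vol : ℝ} {T : ℕ → Finset σ} {Bad : ℕ → ℝ → Finset σ} {A B : ℕ → ℝ → σ → ℝ}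
  {R : Readings ι X} {W : Set (ℕ → ℝ)} {EA : Functional C C.BgA} {EB : Functional C C.BgB}
  {κ θ₅ C₅ C₉ ω θc Cd γ C₃ θ₃ : ℝ} {Λm : ℕ → ℕ → ℝ}
  {g : ℕ → ℕ → ℝ} {uA : ℕ → ι → C.BgA} {uB : ℕ → ι → C.BgB}

/-! ## §1 Knit v7: (T) from the analytic-margin reading + the upper running of the couplings -/

/-- **KNIT v7 — THE N19 EDGE WITH (S), (M) AND THE BRACKET (T) BY NAME** [bookkeeping].  Knit v6's hypotheses VERBATIM except that the bracket
`LipBackground EA W κ CU ∧ PolyLipGrowth CU g Pg q` is REPLACED by the analytic-margin reading of run A's functional (the SHAPE of [III] (2.27)(ii):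
embedding `ιE`, domains `Dm`, radii `ϱ > 0`, holomorphic extensions `Ec` bounded by `E₀m·e^{−κd}`, real agreement, margin balls, gauge domination),
the margin in coupling units `c₀·s j ≤ ϱ s j` ((2.28)) and the upper running `1∕(g K j)² ≤ 1∕gIR² + β′(K − j)`, `j ≤ K` ((2.6) ∕ (0.31)).  Then
`LipBackground EA W κ (4E₀m∕ϱ)` (`lipBackground_of_analyticMargin`) and `PolyLipGrowth (4E₀m∕ϱ) g ((4E₀m∕c₀)(1∕gIR + √β′)) 1`
(`polyLipGrowth_of_couplingMargin`, positivity from the box) feed v6.  CONDITIONAL on every binder; NOT NE7; N19 NOT discharged. [folklore] -/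
theorem core_summable_of_ledgerAtSync_marginByName
    (hL : ∀ (S : ℕ → ℝ → σ → ℕ → ℝ) (E₀ : ℝ) (m : ℕ) (a : ℝ) (Cw Λg : ℝ),
      (∀ K t, |t| ≤ l₀ → ∀ τ ∈ T K \ Bad K t, ∀ v ∈ R.dom, ∀ j ≤ K,
        |∑ X ∈ L.fac K t τ with C.scale X = j,
            (Real.log (Real.exp (EB (fun i => g (K + 1) (i + 1)) (uB K v) X
                - EB (fun i => g (K + 1) (i + 1)) L.oneB X))
              - Real.log (Real.exp (EA (g K) (uA K v) X - EA (g K) L.oneA X)))| ≤ S K t τ j) →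
      0 ≤ E₀ → 0 < a → a < 1 →
      (∀ K t, |t| ≤ l₀ → ∀ τ ∈ T K \ Bad K t, ∀ j ≤ K,
        S K t τ j ≤ vol * (E₀ * ((K : ℝ) + 1) ^ m * a ^ (K - j))) →
      (∀ K, Multiplicity (L.All K) C.scale (fun X => Real.exp (-(κ * C.d X))) Cw vol Λg K) →
      (∀ K t, |t| ≤ l₀ → ∀ τ ∈ T K \ Bad K t,
        WindowMultiplicity (L.facO K t τ) L.scO L.wO Cw vol Λg (jlogOf L.Cl K) K) →
      1 ≤ Λg → L.θ' ≤ Λg →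
      LedgerAtSync { L with S := S, E₀ := E₀, m := m, a := a, Cw := Cw, Λg := Λg } l₀ vol T Bad A B R EA EB κ g uA uB
        ω θc θ₅ θ₃)
    (hvol : 0 ≤ vol)
    -- the record's own window census of the recent node-U5b ledger and its base letters
    (homult : ∀ K t, |t| ≤ l₀ → ∀ τ ∈ T K \ Bad K t,
      WindowMultiplicity (L.facO K t τ) L.scO L.wO L.Cw vol L.Λg (jlogOf L.Cl K) K)
    (hCw : 0 ≤ L.Cw) (hΛg : 1 ≤ L.Λg) (hθΛ : L.θ' ≤ L.Λg)
    -- (m) the reference ledger's lattice identification, per cutoff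
    (Pf : ℕ → Params) {d₀ L₀ Koff : ℕ}
    (hPd : ∀ K, (Pf K).d = d₀) (hPL : ∀ K, (Pf K).L = L₀) (hPK : ∀ K, (Pf K).K = Koff + K)
    (hcard : ∀ K, (Fintype.card (Site (Pf K) (Pf K).K) : ℝ) = vol)
    (hκ₀ : kappa₀ (4 * 2 ^ d₀) (2 * d₀) ≤ κ)
    (cells : (K j : ℕ) → C.Dom → Finset (Site (Pf K) j))
    (hdom : ∀ K, ∀ X ∈ L.All K, (cells K (C.scale X + Koff) X).Nonempty ∧ TFaceConnected (cells K (C.scale X + Koff) X))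
    (hinj : ∀ K j, Set.InjOn (cells K j) ↑((L.All K).filter fun X => C.scale X + Koff = j))
    (hlen : ∀ K, ∀ X ∈ L.All K, torusTreeLen (cells K (C.scale X + Koff) X) ≤ C.d X)
    -- [III] Theorem 2 (2.43) AS PRINTED, one family containing both runs
    (H033 : Flow → ℕ → Prop) {I : Type} (fam : I → B14.Sect2Data) {Lb β : ℝ} {κ₁ : ℕ}
    (h11 : B14.Thm2Printed H033 fam Lb β κ₁) (hβ1 : β < 1) (hβ0 : 0 < β) (hLb : 1 < Lb)
    {Gv Cl : ℝ} (hGv : 1 ≤ Gv) (hCl : 0 ≤ Cl) (K₁ : ℕ)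
    -- node N14, the pinned pair
    {P : Type*} {𝒯 : DressedTower P} {Λ Λ₀ N₀ : ℝ}
    (h14 : DressedStabilityStrict 𝒯 Λ ∧ ∀ p K, (𝒯.B p K).PositionalCount fun j k => N₀ * Λ₀ ^ (k - j))
    (hN₀ : 0 ≤ N₀) (hΛ₀ : 0 ≤ Λ₀) (hle : Λ₀ ≤ Λ)
    (dressed : C.Dom → Prop) [DecidablePred dressed]
    -- (v-A) run A's vacuum slices ↔ printed E-terms
    (hidA : ∀ K t, |t| ≤ l₀ → ∀ τ ∈ T K \ Bad K t, ∀ v ∈ R.dom, ∀ j ≤ K, ∃ (i : I) (w : (fam i).Ω) (j' : ℕ),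
      (fam i).flow.SatisfiesRG (fam i).K ∧ H033 (fam i).flow (fam i).K ∧ 1 ≤ j' ∧ j' ≤ (fam i).K ∧
      (fam i).K - j' = K - j ∧ (fam i).K ≤ K + K₁ ∧
      (∀ n, 0 ≤ (fam i).gammaVol n w) ∧ (fam i).gammaVol (fam i).K w ≤ vol ∧
      (∀ n, n < (fam i).K → n < jlogOf Cl (fam i).K → (fam i).gammaVol n w = 0) ∧
      (∀ n, n < (fam i).K → jlogOf Cl (fam i).K ≤ n → (fam i).gammaVol n w ≤ vol * Gv ^ ((fam i).K - n)) ∧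
      |∑ X ∈ (L.fac K t τ).filter (fun X => ¬ dressed X) with C.scale X = j,
          (EA (g K) (uA K v) X - EA (g K) L.oneA X)| ≤ |(fam i).eTerm j' (fam i).K w|)
    -- (v-B) run B's vacuum slices ↔ printed E-terms
    (hidB : ∀ K t, |t| ≤ l₀ → ∀ τ ∈ T K \ Bad K t, ∀ v ∈ R.dom, ∀ j ≤ K, ∃ (i : I) (w : (fam i).Ω) (j' : ℕ),
      (fam i).flow.SatisfiesRG (fam i).K ∧ H033 (fam i).flow (fam i).K ∧ 1 ≤ j' ∧ j' ≤ (fam i).K ∧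
      (fam i).K - j' = K - j ∧ (fam i).K ≤ K + K₁ ∧
      (∀ n, 0 ≤ (fam i).gammaVol n w) ∧ (fam i).gammaVol (fam i).K w ≤ vol ∧
      (∀ n, n < (fam i).K → n < jlogOf Cl (fam i).K → (fam i).gammaVol n w = 0) ∧
      (∀ n, n < (fam i).K → jlogOf Cl (fam i).K ≤ n → (fam i).gammaVol n w ≤ vol * Gv ^ ((fam i).K - n)) ∧
      |∑ X ∈ (L.fac K t τ).filter (fun X => ¬ dressed X) with C.scale X = j,
          (EB (fun i => g (K + 1) (i + 1)) (uB K v) X - EB (fun i => g (K + 1) (i + 1)) L.oneB X)|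
        ≤ |(fam i).eTerm j' (fam i).K w|)
    -- (d) the dressed sub-ledger ↔ N14's bookings
    (hidD : ∀ K t, |t| ≤ l₀ → ∀ τ ∈ T K \ Bad K t, ∀ v ∈ R.dom,
      ∃ (pA : P) (βA : C.Dom → (𝒯.B pA K).Birth) (Q : Finset (𝒯.B pA K).Cube) (pB : P) (KB : ℕ)
        (βB : C.Dom → (𝒯.B pB KB).Birth),
      (∀ X ∈ (L.fac K t τ).filter (fun X => dressed X), (𝒯.B pA K).birthScale (βA X) = C.scale X) ∧
      (∀ j, Set.InjOn βA ↑(((L.fac K t τ).filter (fun X => dressed X)).filter fun X => C.scale X = j)) ∧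
      (∀ c ∈ Q, (𝒯.B pA K).cubeScale c = K) ∧ ((Q.card : ℝ) ≤ vol) ∧
      (∀ X ∈ (L.fac K t τ).filter (fun X => dressed X), ∃ c ∈ Q, βA X ∈ (𝒯.B pA K).feltAt c) ∧
      (∀ X ∈ (L.fac K t τ).filter (fun X => dressed X), KB - (𝒯.B pB KB).birthScale (βB X) = K - C.scale X) ∧
      (∀ X ∈ (L.fac K t τ).filter (fun X => dressed X),
        |EA (g K) (uA K v) X - EA (g K) L.oneA X| ≤ (𝒯.B pA K).size (βA X) K) ∧
      (∀ X ∈ (L.fac K t τ).filter (fun X => dressed X),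
        |EB (fun i => g (K + 1) (i + 1)) (uB K v) X - EB (fun i => g (K + 1) (i + 1)) L.oneB X|
          ≤ (𝒯.B pB KB).size (βB X) KB))
    -- the in-edges BY NAME and the bracket (T), as in `core_summable_of_ledgerAtSync`
    (h16 : NE3Shape R C₃ θ₃) (hC₃ : 0 ≤ C₃) (hgd : GaugeDominated R uA uB)
    (h18 : NE5 EA EB W κ θ₅ C₅) (hθ₅ : 0 ≤ θ₅) (hC₅ : 0 ≤ C₅)
    (h22 : NE9 EA W κ Λm ∧ T4OutputRate.FadingMemory C₉ ω Λm) (hω : 0 ≤ ω)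
    (hinj17 : InjectedRate Cd 0 θc (fun K j => T4CouplingMatching.disc (g K) (g (K + 1)) j)) (hCd : 0 ≤ Cd)
    (hθc : 0 ≤ θc) (hbox : ∀ K i, i ≤ K → 0 < g K i ∧ g K i ≤ γ)
    -- (T) BY NAME: [III] (2.27)(ii)'s analytic-margin SHAPE for run A's E-terms + (2.28) margin in coupling units + the
    -- upper running of the inverse squared couplings ((2.6)∕(0.31)) from the renormalised coupling `gIR`
    {E : Type*} [NormedAddCommGroup E] [NormedSpace ℂ E]
    (ιE : C.BgA → E) (Dm : (ℕ → ℝ) → C.Dom → Set E) (ϱ : (ℕ → ℝ) → ℕ → ℝ) (Ec : (ℕ → ℝ) → C.Dom → E → ℂ) {E₀m c₀ β' gIR : ℝ}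
    (hϱ : ∀ s ∈ W, ∀ j, 0 < ϱ s j)
    (hhol : ∀ s ∈ W, ∀ X : C.Dom, DifferentiableOn ℂ (Ec s X) (Dm s X))
    (hbd : ∀ s ∈ W, ∀ X : C.Dom, ∀ z ∈ Dm s X, ‖Ec s X z‖ ≤ E₀m * Real.exp (-(κ * C.d X)))
    (hmargin : ∀ s ∈ W, ∀ (X : C.Dom) (U : C.BgA), Metric.closedBall (ιE U) (ϱ s (C.scale X)) ⊆ Dm s X)
    (hreal : ∀ s ∈ W, ∀ (X : C.Dom) (U : C.BgA), Ec s X (ιE U) = (EA s U X : ℂ))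
    (hgauge : ∀ U U' : C.BgA, ‖ιE U - ιE U'‖ ≤ C.gauge U U')
    (hE₀m : 0 ≤ E₀m) (hm : ∀ s ∈ W, ∀ j : ℕ, c₀ * s j ≤ ϱ s j) (hc₀ : 0 < c₀)
    (hup : ∀ K j, j ≤ K → 1 / g K j ^ 2 ≤ 1 / gIR ^ 2 + β' * ((K : ℝ) - j)) (hgIR : 0 < gIR) (hβ' : 0 ≤ β')
    (hgA : ∀ K, g K ∈ W) (hgB : ∀ K, (fun i => g (K + 1) (i + 1)) ∈ W) :
    ∃ δ : ℕ → ℝ, NE7.Core l₀ vol T Bad A B δ ∧ Summable δ :=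
  have hU : LipBackground EA W κ (fun s j => 4 * E₀m / ϱ s j) :=
    lipBackground_of_analyticMargin ιE Dm ϱ Ec hϱ hhol hbd hmargin hreal hgauge
  have hG : PolyLipGrowth (fun s j => 4 * E₀m / ϱ s j) g (4 * E₀m / c₀ * (1 / gIR + Real.sqrt β')) 1 :=
    polyLipGrowth_of_couplingMargin hm hc₀ hE₀m hgA (fun K j hj => (hbox K j hj).1) hup hgIR hβ'
  have hPg : 0 ≤ 4 * E₀m / c₀ * (1 / gIR + Real.sqrt β') := by positivity
  core_summable_of_ledgerAtSync_multByName hL hvol homult hCw hΛg hθΛ Pf hPd hPL hPK hcard hκ₀ cells hdom hinj hlen H033 fam h11 hβ1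
    hβ0 hLb hGv hCl K₁ h14 hN₀ hΛ₀ hle dressed hidA hidB hidD h16 hC₃ hgd h18 hθ₅ hC₅ h22 hω hinj17 hCd hθc hbox hU hG hPg hgA hgB

/-! ## §2 The printed (2.6) instance: `B14.FlowIneq26` at every cutoff table with the infrared pin -/

/-- **KNIT v7 WITH THE PRINTED FLOW CONTROL (2.6).**  As `core_summable_of_ledgerAtSync_marginByName`, the running clause SUPPLIED by
[III] (2.6) AS PRINTED — `B14.FlowIneq26 (g K) β′ β₀ K` for every cutoff table — and the infrared pin `g K K = gIR` (tables indexed with the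
cutoff at index `K`), by `T4TowerRateDischarge.invSq_le_of_flowIneq26`.  (2.6) is printed as a consequence of (0.20) and the β-function
properties — the same conditional as (0.31) (cell police rule P7).  CONDITIONAL on every binder; NOT NE7. [folklore] -/
theorem core_summable_of_ledgerAtSync_flow26ByName
    (hL : ∀ (S : ℕ → ℝ → σ → ℕ → ℝ) (E₀ : ℝ) (m : ℕ) (a : ℝ) (Cw Λg : ℝ),
      (∀ K t, |t| ≤ l₀ → ∀ τ ∈ T K \ Bad K t, ∀ v ∈ R.dom, ∀ j ≤ K,
        |∑ X ∈ L.fac K t τ with C.scale X = j,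
            (Real.log (Real.exp (EB (fun i => g (K + 1) (i + 1)) (uB K v) X
                - EB (fun i => g (K + 1) (i + 1)) L.oneB X))
              - Real.log (Real.exp (EA (g K) (uA K v) X - EA (g K) L.oneA X)))| ≤ S K t τ j) →
      0 ≤ E₀ → 0 < a → a < 1 →
      (∀ K t, |t| ≤ l₀ → ∀ τ ∈ T K \ Bad K t, ∀ j ≤ K,
        S K t τ j ≤ vol * (E₀ * ((K : ℝ) + 1) ^ m * a ^ (K - j))) →
      (∀ K, Multiplicity (L.All K) C.scale (fun X => Real.exp (-(κ * C.d X))) Cw vol Λg K) →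
      (∀ K t, |t| ≤ l₀ → ∀ τ ∈ T K \ Bad K t,
        WindowMultiplicity (L.facO K t τ) L.scO L.wO Cw vol Λg (jlogOf L.Cl K) K) →
      1 ≤ Λg → L.θ' ≤ Λg →
      LedgerAtSync { L with S := S, E₀ := E₀, m := m, a := a, Cw := Cw, Λg := Λg } l₀ vol T Bad A B R EA EB κ g uA uB
        ω θc θ₅ θ₃)
    (hvol : 0 ≤ vol)
    -- the record's own window census of the recent node-U5b ledger and its base letters
    (homult : ∀ K t, |t| ≤ l₀ → ∀ τ ∈ T K \ Bad K t,
      WindowMultiplicity (L.facO K t τ) L.scO L.wO L.Cw vol L.Λg (jlogOf L.Cl K) K)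
    (hCw : 0 ≤ L.Cw) (hΛg : 1 ≤ L.Λg) (hθΛ : L.θ' ≤ L.Λg)
    -- (m) the reference ledger's lattice identification, per cutoff
    (Pf : ℕ → Params) {d₀ L₀ Koff : ℕ}
    (hPd : ∀ K, (Pf K).d = d₀) (hPL : ∀ K, (Pf K).L = L₀) (hPK : ∀ K, (Pf K).K = Koff + K)
    (hcard : ∀ K, (Fintype.card (Site (Pf K) (Pf K).K) : ℝ) = vol)
    (hκ₀ : kappa₀ (4 * 2 ^ d₀) (2 * d₀) ≤ κ)
    (cells : (K j : ℕ) → C.Dom → Finset (Site (Pf K) j))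
    (hdom : ∀ K, ∀ X ∈ L.All K, (cells K (C.scale X + Koff) X).Nonempty ∧ TFaceConnected (cells K (C.scale X + Koff) X))
    (hinj : ∀ K j, Set.InjOn (cells K j) ↑((L.All K).filter fun X => C.scale X + Koff = j))
    (hlen : ∀ K, ∀ X ∈ L.All K, torusTreeLen (cells K (C.scale X + Koff) X) ≤ C.d X)
    -- [III] Theorem 2 (2.43) AS PRINTED, one family containing both runs
    (H033 : Flow → ℕ → Prop) {I : Type} (fam : I → B14.Sect2Data) {Lb β : ℝ} {κ₁ : ℕ}
    (h11 : B14.Thm2Printed H033 fam Lb β κ₁) (hβ1 : β < 1) (hβ0 : 0 < β) (hLb : 1 < Lb)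
    {Gv Cl : ℝ} (hGv : 1 ≤ Gv) (hCl : 0 ≤ Cl) (K₁ : ℕ)
    -- node N14, the pinned pair
    {P : Type*} {𝒯 : DressedTower P} {Λ Λ₀ N₀ : ℝ}
    (h14 : DressedStabilityStrict 𝒯 Λ ∧ ∀ p K, (𝒯.B p K).PositionalCount fun j k => N₀ * Λ₀ ^ (k - j))
    (hN₀ : 0 ≤ N₀) (hΛ₀ : 0 ≤ Λ₀) (hle : Λ₀ ≤ Λ)
    (dressed : C.Dom → Prop) [DecidablePred dressed]
    -- (v-A) run A's vacuum slices ↔ printed E-terms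
    (hidA : ∀ K t, |t| ≤ l₀ → ∀ τ ∈ T K \ Bad K t, ∀ v ∈ R.dom, ∀ j ≤ K, ∃ (i : I) (w : (fam i).Ω) (j' : ℕ),
      (fam i).flow.SatisfiesRG (fam i).K ∧ H033 (fam i).flow (fam i).K ∧ 1 ≤ j' ∧ j' ≤ (fam i).K ∧
      (fam i).K - j' = K - j ∧ (fam i).K ≤ K + K₁ ∧
      (∀ n, 0 ≤ (fam i).gammaVol n w) ∧ (fam i).gammaVol (fam i).K w ≤ vol ∧
      (∀ n, n < (fam i).K → n < jlogOf Cl (fam i).K → (fam i).gammaVol n w = 0) ∧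
      (∀ n, n < (fam i).K → jlogOf Cl (fam i).K ≤ n → (fam i).gammaVol n w ≤ vol * Gv ^ ((fam i).K - n)) ∧
      |∑ X ∈ (L.fac K t τ).filter (fun X => ¬ dressed X) with C.scale X = j,
          (EA (g K) (uA K v) X - EA (g K) L.oneA X)| ≤ |(fam i).eTerm j' (fam i).K w|)
    -- (v-B) run B's vacuum slices ↔ printed E-terms
    (hidB : ∀ K t, |t| ≤ l₀ → ∀ τ ∈ T K \ Bad K t, ∀ v ∈ R.dom, ∀ j ≤ K, ∃ (i : I) (w : (fam i).Ω) (j' : ℕ),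
      (fam i).flow.SatisfiesRG (fam i).K ∧ H033 (fam i).flow (fam i).K ∧ 1 ≤ j' ∧ j' ≤ (fam i).K ∧
      (fam i).K - j' = K - j ∧ (fam i).K ≤ K + K₁ ∧
      (∀ n, 0 ≤ (fam i).gammaVol n w) ∧ (fam i).gammaVol (fam i).K w ≤ vol ∧
      (∀ n, n < (fam i).K → n < jlogOf Cl (fam i).K → (fam i).gammaVol n w = 0) ∧
      (∀ n, n < (fam i).K → jlogOf Cl (fam i).K ≤ n → (fam i).gammaVol n w ≤ vol * Gv ^ ((fam i).K - n)) ∧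
      |∑ X ∈ (L.fac K t τ).filter (fun X => ¬ dressed X) with C.scale X = j,
          (EB (fun i => g (K + 1) (i + 1)) (uB K v) X - EB (fun i => g (K + 1) (i + 1)) L.oneB X)|
        ≤ |(fam i).eTerm j' (fam i).K w|)
    -- (d) the dressed sub-ledger ↔ N14's bookings
    (hidD : ∀ K t, |t| ≤ l₀ → ∀ τ ∈ T K \ Bad K t, ∀ v ∈ R.dom,
      ∃ (pA : P) (βA : C.Dom → (𝒯.B pA K).Birth) (Q : Finset (𝒯.B pA K).Cube) (pB : P) (KB : ℕ)
        (βB : C.Dom → (𝒯.B pB KB).Birth),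
      (∀ X ∈ (L.fac K t τ).filter (fun X => dressed X), (𝒯.B pA K).birthScale (βA X) = C.scale X) ∧
      (∀ j, Set.InjOn βA ↑(((L.fac K t τ).filter (fun X => dressed X)).filter fun X => C.scale X = j)) ∧
      (∀ c ∈ Q, (𝒯.B pA K).cubeScale c = K) ∧ ((Q.card : ℝ) ≤ vol) ∧
      (∀ X ∈ (L.fac K t τ).filter (fun X => dressed X), ∃ c ∈ Q, βA X ∈ (𝒯.B pA K).feltAt c) ∧
      (∀ X ∈ (L.fac K t τ).filter (fun X => dressed X), KB - (𝒯.B pB KB).birthScale (βB X) = K - C.scale X) ∧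
      (∀ X ∈ (L.fac K t τ).filter (fun X => dressed X),
        |EA (g K) (uA K v) X - EA (g K) L.oneA X| ≤ (𝒯.B pA K).size (βA X) K) ∧
      (∀ X ∈ (L.fac K t τ).filter (fun X => dressed X),
        |EB (fun i => g (K + 1) (i + 1)) (uB K v) X - EB (fun i => g (K + 1) (i + 1)) L.oneB X|
          ≤ (𝒯.B pB KB).size (βB X) KB))
    -- the in-edges BY NAME and the bracket (T), as in `core_summable_of_ledgerAtSync`
    (h16 : NE3Shape R C₃ θ₃) (hC₃ : 0 ≤ C₃) (hgd : GaugeDominated R uA uB)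
    (h18 : NE5 EA EB W κ θ₅ C₅) (hθ₅ : 0 ≤ θ₅) (hC₅ : 0 ≤ C₅)
    (h22 : NE9 EA W κ Λm ∧ T4OutputRate.FadingMemory C₉ ω Λm) (hω : 0 ≤ ω)
    (hinj17 : InjectedRate Cd 0 θc (fun K j => T4CouplingMatching.disc (g K) (g (K + 1)) j)) (hCd : 0 ≤ Cd)
    (hθc : 0 ≤ θc) (hbox : ∀ K i, i ≤ K → 0 < g K i ∧ g K i ≤ γ)
    -- (T) BY NAME: [III] (2.27)(ii)'s analytic-margin SHAPE for run A's E-terms + (2.28) margin in coupling units + the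
    -- upper running of the inverse squared couplings ((2.6)∕(0.31)) from the renormalised coupling `gIR`
    {E : Type*} [NormedAddCommGroup E] [NormedSpace ℂ E]
    (ιE : C.BgA → E) (Dm : (ℕ → ℝ) → C.Dom → Set E) (ϱ : (ℕ → ℝ) → ℕ → ℝ) (Ec : (ℕ → ℝ) → C.Dom → E → ℂ) {E₀m c₀ β' β₀ gIR : ℝ}
    (hϱ : ∀ s ∈ W, ∀ j, 0 < ϱ s j)
    (hhol : ∀ s ∈ W, ∀ X : C.Dom, DifferentiableOn ℂ (Ec s X) (Dm s X))
    (hbd : ∀ s ∈ W, ∀ X : C.Dom, ∀ z ∈ Dm s X, ‖Ec s X z‖ ≤ E₀m * Real.exp (-(κ * C.d X)))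
    (hmargin : ∀ s ∈ W, ∀ (X : C.Dom) (U : C.BgA), Metric.closedBall (ιE U) (ϱ s (C.scale X)) ⊆ Dm s X)
    (hreal : ∀ s ∈ W, ∀ (X : C.Dom) (U : C.BgA), Ec s X (ιE U) = (EA s U X : ℂ))
    (hgauge : ∀ U U' : C.BgA, ‖ιE U - ιE U'‖ ≤ C.gauge U U')
    (hE₀m : 0 ≤ E₀m) (hm : ∀ s ∈ W, ∀ j : ℕ, c₀ * s j ≤ ϱ s j) (hc₀ : 0 < c₀)
    (h26 : ∀ K, B14.FlowIneq26 (g K) β' β₀ K) (hpin : ∀ K, g K K = gIR) (hgIR : 0 < gIR) (hβ' : 0 ≤ β')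
    (hgA : ∀ K, g K ∈ W) (hgB : ∀ K, (fun i => g (K + 1) (i + 1)) ∈ W) :
    ∃ δ : ℕ → ℝ, NE7.Core l₀ vol T Bad A B δ ∧ Summable δ :=
  core_summable_of_ledgerAtSync_marginByName hL hvol homult hCw hΛg hθΛ Pf hPd hPL hPK hcard hκ₀ cells hdom hinj hlen H033 fam h11 hβ1 hβ0
    hLb hGv hCl K₁ h14 hN₀ hΛ₀ hle dressed hidA hidB hidD h16 hC₃ hgd h18 hθ₅ hC₅ h22 hω hinj17 hCd hθc hbox ιE Dm ϱ Ec hϱ hhol hbd hmargin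
    hreal hgauge hE₀m hm hc₀ (fun K j hj => by
      rw [← hpin K]; exact invSq_le_of_flowIneq26 (h26 K) (fun i hi => (hbox K i hi).1) hβ' hj) hgIR hβ' hgA hgB

end Edge

end Summit.QuantumFields.YangMills.BalabanUVNodes.N19MarginByName

end
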